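import Summits.FinalStateConjecture.FinalStateConjecture.Theorems.LaminatedThresholdAdaptedCombReduction

/-!
# Crux `LaminatedThreshold` · line `caged comb` (SketchIdeator1 reshaped) — the composition

Support file for crux item stmt-FinalStateConjecture-16893 (route LaminatedThreshold, crux A), line lead,
2026-08-17. The re-typed comb line (`Theorems/LaminatedThresholdAdaptedCombReduction.lean`) reduces the crux
to: adapted comb lemma → ADAPTED vacuum comb carrier → (naked developments are exceptional). Its carrier
hands over a `C¹` period map `T` of `E × ℝ` whose linearisation at the naked saddle is `(S, μ)` with
`‖S‖ < 1 < μ` — contraction of the complement of the unstable direction IN THE GIVEN NORM.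

Idea card `equivariant-cage` (Cruxes/LaminatedThreshold/Ideas/equivariant-cage.md) builds the saddle inside
the symmetric (caged) flow and controls the non-symmetric directions mode by mode; its linear lemma
(`CageLemma`, Cruxes/LaminatedThreshold/SketchIdeator1.lean) delivers only `‖S ^ n‖ ≤ C θ ^ n` with
`C = ‖P‖ + ‖1 - P‖ ≥ 1` (the symmetrising projection `P` need not have norm one), i.e. EVENTUAL contraction
`‖S ^ (N+1)‖ < 1` — equivalently spectral radius `< 1`, the norm-free form of "index-one hyperbolicity".
This file proves that the weaker, norm-free hypothesis suffices:

* `exists_mapsTo_iterate_ball` — iterates of a map continuous on a ball and fixing its centre keep small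
  balls inside any prescribed ball, uniformly over finitely many iterates;
* `linearisation_pow` — `((S ∘ fst, μ • snd)) ^ n = (S ^ n ∘ fst, μ ^ n • snd)`;
* `adaptedCombCarrier_of_cagedCombCarrier` — **a CAGED vacuum comb carrier (period map `T`, complement
  eventually contracted) yields an ADAPTED one (period map `T^[N+1]`)**: the iterate is `C¹` on a shrunken
  ball, fixes `0`, has linearisation `(S ^ (N+1), μ ^ (N+1))`, keeps the `t`-axis invariant on the shrunken
  ball, and its orbit trichotomy (stay small / land on the upper seed sheet / land on the lower one) implies
  the trichotomy for `T` once the smallness radius is shrunk so that the first `N` iterates of `T` map it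
  into the carrier's radius — so the carrier's nakedness dictionary is reused verbatim;
* `exists_norm_pow_lt_one_of_cage` — the cage lemma in the form consumed here: symmetric part `θ`-contracted
  on an invariant stable subspace containing `range P`, non-symmetric part (`ker P`) `θ`-contracted, `P`
  idempotent commuting with `L`, `0 ≤ θ < 1` ⟹ `∃ N, ‖L ^ (N+1)‖ < 1`;
* `laminatedThreshold_of_cagedComb` — **adapted comb lemma → caged vacuum comb carrier → (naked developments
  are exceptional) → `LaminatedThreshold`** (by name), the composition of the reshaped line.

Mathlib + the landed reduction only; no definitions, no named facts.
-/

-- every `Summit.FinalStateConjecture.FinalStateConjecture.…` name repeats the summit = sub-problem segment (D-0017 layout)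
set_option linter.dupNamespace false

noncomputable section

open Set Filter Metric Function Topology
open scoped Manifold ContDiff
open Literature.Geometry.Lorentzian
open Summit.FinalStateConjecture.FinalStateConjecture.Theses.LaminatedThreshold

namespace Summit.FinalStateConjecture.FinalStateConjecture.Theorems.LaminatedThreshold.CagedComb

section Iterates

variable {V : Type*} [NormedAddCommGroup V]

/-- Iterates of a map continuous on `ball 0 r₀` and fixing `0` map a small enough ball `ball 0 η`,
`η ≤ ε`, into `ball 0 ε`, simultaneously for the first `k` iterates. [folklore] -/
theorem exists_mapsTo_iterate_ball {T : V → V} {r₀ : ℝ} (hT : ContinuousOn T (ball 0 r₀))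
    (hT0 : T 0 = 0) (hr₀ : 0 < r₀) :
    ∀ (k : ℕ) (ε : ℝ), 0 < ε → ∃ η : ℝ, 0 < η ∧ η ≤ ε ∧ ∀ j ≤ k, MapsTo T^[j] (ball 0 η) (ball 0 ε) := by
  have hat : ContinuousAt T 0 := hT.continuousAt (ball_mem_nhds 0 hr₀)
  -- one step: `T` maps a small ball into any prescribed ball
  have hstep : ∀ ε : ℝ, 0 < ε → ∃ η : ℝ, 0 < η ∧ η ≤ ε ∧ MapsTo T (ball 0 η) (ball 0 ε) := by
    intro ε hε
    obtain ⟨η, hη, hmap⟩ := Metric.continuousAt_iff.1 hat ε hε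
    refine ⟨min η ε, lt_min hη hε, min_le_right _ _, fun x hx ↦ ?_⟩
    have hx' : dist x 0 < η := lt_of_lt_of_le (mem_ball.1 hx) (min_le_left _ _)
    have := hmap hx'
    rwa [hT0, ← mem_ball] at this
  intro k
  induction k with
  | zero =>
    intro ε hε
    refine ⟨ε, hε, le_rfl, fun j hj ↦ ?_⟩
    obtain rfl : j = 0 := Nat.le_zero.1 hj
    exact fun x hx ↦ hx
  | succ k ih =>
    intro ε hε
    obtain ⟨η₁, hη₁, hη₁ε, hmap₁⟩ := hstep ε hε
    obtain ⟨η, hη, hηη₁, hmap⟩ := ih η₁ hη₁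
    refine ⟨η, hη, hηη₁.trans hη₁ε, fun j hj ↦ ?_⟩
    rcases Nat.lt_or_eq_of_le hj with hlt | rfl
    · exact (hmap j (Nat.lt_succ_iff.1 hlt)).mono_right (ball_subset_ball hη₁ε)
    · intro x hx
      rw [iterate_succ_apply']
      exact hmap₁ (hmap k le_rfl hx)

end Iterates

section Linearisation

variable {E : Type} [NormedAddCommGroup E] [NormedSpace ℝ E]

/-- Powers of the block-diagonal linearisation `(x, t) ↦ (S x, μ t)`. [folklore] -/
theorem linearisation_pow (S : E →L[ℝ] E) (μ : ℝ) (n : ℕ) :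
    ((S.comp (ContinuousLinearMap.fst ℝ E ℝ)).prod (μ • ContinuousLinearMap.snd ℝ E ℝ)) ^ n =
      ((S ^ n).comp (ContinuousLinearMap.fst ℝ E ℝ)).prod (μ ^ n • ContinuousLinearMap.snd ℝ E ℝ) := by
  induction n with
  | zero =>
    refine ContinuousLinearMap.ext fun p ↦ ?_
    obtain ⟨x, t⟩ := p
    simp
  | succ n ih =>
    rw [pow_succ, ih]
    refine ContinuousLinearMap.ext fun p ↦ ?_
    obtain ⟨x, t⟩ := p
    refine Prod.ext ?_ ?_
    · simp [pow_succ]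
    · simp only [mul_apply_eq_comp, ContinuousLinearMap.prod_apply,
        ContinuousLinearMap.coe_comp, Function.comp_apply, ContinuousLinearMap.coe_fst',
        ContinuousLinearMap.coe_snd', smul_apply, smul_eq_mul]
      ring

omit [NormedSpace ℝ E] in
/-- On the `t`-axis the iterates stay on the axis as long as they stay in the ball of invariance.
[folklore] -/
theorem iterate_axis {T : E × ℝ → E × ℝ} {r₀ η : ℝ} (haxis : ∀ t : ℝ, |t| < r₀ → (T ((0 : E), t)).1 = 0)
    {k : ℕ} (hmaps : ∀ j ≤ k, MapsTo T^[j] (ball (0 : E × ℝ) η) (ball 0 r₀)) :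
    ∀ j ≤ k + 1, ∀ t : ℝ, |t| < η → (T^[j] ((0 : E), t)).1 = 0 := by
  intro j
  induction j with
  | zero => intro _ t _; simp
  | succ j ih =>
    intro hj t ht
    have hj' : j ≤ k := Nat.succ_le_succ_iff.1 hj
    have hmem : ((0 : E), t) ∈ ball (0 : E × ℝ) η := by
      rw [mem_ball_zero_iff, Prod.norm_mk, norm_zero, Real.norm_eq_abs, max_eq_right (abs_nonneg t)]
      exact ht
    have hin : T^[j] ((0 : E), t) ∈ ball (0 : E × ℝ) r₀ := hmaps j hj' hmem
    have hfst : (T^[j] ((0 : E), t)).1 = 0 := ih (hj'.trans (Nat.le_succ k)) t ht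
    -- write the `j`-th iterate as a point of the axis inside the ball of invariance
    rcases hq : T^[j] ((0 : E), t) with ⟨a, b⟩
    simp only [hq] at hfst hin
    subst hfst
    have hb : |b| < r₀ := by
      rw [mem_ball_zero_iff, Prod.norm_mk, norm_zero, Real.norm_eq_abs, max_eq_right (abs_nonneg b)] at hin
      exact hin
    rw [iterate_succ_apply', hq]
    exact haxis b hb

end Linearisation

section Cage

variable {E : Type} [NormedAddCommGroup E] [NormedSpace ℝ E]

/-- **The cage lemma, eventual-contraction form.** If `P` is an idempotent continuous linear map commuting
with `L`, `Vs` an `L`-invariant subspace fixed by `P` and containing `range P` on which `L` contracts by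
`θ`, and `L` contracts `ker P` by `θ`, with `0 ≤ θ < 1`, then some power of `L` has operator norm `< 1`
(indeed `‖L ^ n‖ ≤ (‖P‖ + ‖1 - P‖) θ ^ n`). This is why a caged carrier delivers only EVENTUAL contraction
of the complement of the unstable direction. [folklore] -/
theorem exists_norm_pow_lt_one_of_cage (L P : E →L[ℝ] E) (Vs : Submodule ℝ E) (θ : ℝ)
    (hθ0 : 0 ≤ θ) (hθ1 : θ < 1) (hcomm : ∀ x, L (P x) = P (L x))
    (hPV : ∀ x, P x ∈ Vs) (hVP : ∀ v ∈ Vs, P v = v) (hLV : ∀ v ∈ Vs, L v ∈ Vs)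
    (hLVs : ∀ v ∈ Vs, ‖L v‖ ≤ θ * ‖v‖) (hLW : ∀ w, P w = 0 → ‖L w‖ ≤ θ * ‖w‖) :
    ∃ N : ℕ, ‖L ^ (N + 1)‖ < 1 := by
  -- contraction on the symmetric stable space
  have hVsn : ∀ n : ℕ, ∀ u ∈ Vs, (L ^ n) u ∈ Vs ∧ ‖(L ^ n) u‖ ≤ θ ^ n * ‖u‖ := by
    intro n
    induction n with
    | zero => intro u hu; simp [hu]
    | succ n ih =>
      intro u hu
      obtain ⟨hmem, hle⟩ := ih u hu
      refine ⟨?_, ?_⟩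
      · rw [pow_succ', mul_apply_eq_comp]; exact hLV _ hmem
      · rw [pow_succ', mul_apply_eq_comp]
        calc ‖L ((L ^ n) u)‖ ≤ θ * ‖(L ^ n) u‖ := hLVs _ hmem
          _ ≤ θ * (θ ^ n * ‖u‖) := by gcongr
          _ = θ ^ (n + 1) * ‖u‖ := by ring
  -- contraction on the non-symmetric part
  have hWn : ∀ n : ℕ, ∀ u, P u = 0 → P ((L ^ n) u) = 0 ∧ ‖(L ^ n) u‖ ≤ θ ^ n * ‖u‖ := by
    intro n
    induction n with
    | zero => intro u hu; simp [hu]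
    | succ n ih =>
      intro u hu
      obtain ⟨hPu, hle⟩ := ih u hu
      refine ⟨?_, ?_⟩
      · rw [pow_succ', mul_apply_eq_comp, ← hcomm, hPu, map_zero]
      · rw [pow_succ', mul_apply_eq_comp]
        calc ‖L ((L ^ n) u)‖ ≤ θ * ‖(L ^ n) u‖ := hLW _ hPu
          _ ≤ θ * (θ ^ n * ‖u‖) := by gcongr
          _ = θ ^ (n + 1) * ‖u‖ := by ring
  set C : ℝ := ‖P‖ + ‖ContinuousLinearMap.id ℝ E - P‖ with hC
  have hC0 : 0 ≤ C := by positivity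
  -- the cage bound on every vector
  have hbound : ∀ n : ℕ, ∀ x : E, ‖(L ^ n) x‖ ≤ C * θ ^ n * ‖x‖ := by
    intro n x
    set v := P x with hv
    set w := x - P x with hw
    have hxvw : x = v + w := by rw [hv, hw]; abel
    have hvV : v ∈ Vs := hPV x
    have hwP : P w = 0 := by
      rw [hw, map_sub]
      have : P (P x) = P x := hVP _ (hPV x)
      rw [this, sub_self]
    have hnv : ‖v‖ ≤ ‖P‖ * ‖x‖ := P.le_opNorm x
    have hnw : ‖w‖ ≤ ‖ContinuousLinearMap.id ℝ E - P‖ * ‖x‖ := by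
      have h := (ContinuousLinearMap.id ℝ E - P).le_opNorm x
      have hid : (ContinuousLinearMap.id ℝ E - P) x = w := by simp [hw]
      rwa [hid] at h
    have h1 := (hVsn n v hvV).2
    have h2 := (hWn n w hwP).2
    have hθn : 0 ≤ θ ^ n := pow_nonneg hθ0 n
    calc ‖(L ^ n) x‖ = ‖(L ^ n) v + (L ^ n) w‖ := by rw [hxvw, map_add]
      _ ≤ ‖(L ^ n) v‖ + ‖(L ^ n) w‖ := norm_add_le _ _
      _ ≤ θ ^ n * ‖v‖ + θ ^ n * ‖w‖ := add_le_add h1 h2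
      _ ≤ θ ^ n * (‖P‖ * ‖x‖) + θ ^ n * (‖ContinuousLinearMap.id ℝ E - P‖ * ‖x‖) := by gcongr
      _ = C * θ ^ n * ‖x‖ := by rw [hC]; ring
  have hopn : ∀ n : ℕ, ‖L ^ n‖ ≤ C * θ ^ n := fun n ↦
    ContinuousLinearMap.opNorm_le_bound _ (by positivity) (hbound n)
  -- choose the power
  obtain ⟨N, hN⟩ := exists_pow_lt_of_lt_one (show 0 < 1 / (C + 1) by positivity) hθ1
  refine ⟨N, lt_of_le_of_lt (hopn (N + 1)) ?_⟩
  have hθN1 : θ ^ (N + 1) ≤ θ ^ N := by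
    rw [pow_succ]
    exact mul_le_of_le_one_right (pow_nonneg hθ0 N) hθ1.le
  have hC1 : C / (C + 1) < 1 := by
    rw [div_lt_one (by positivity)]; linarith
  calc C * θ ^ (N + 1) ≤ C * θ ^ N := by gcongr
    _ ≤ C * (1 / (C + 1)) := by gcongr
    _ = C / (C + 1) := by ring
    _ < 1 := hC1

end Cage

/-- **A caged vacuum comb carrier yields an adapted one.** The caged carrier is the adapted vacuum comb
carrier of `laminatedThreshold_of_adaptedComb_verbatim` with the contraction hypothesis `‖S‖ < 1` on the
complement of the unstable direction weakened to eventual contraction `∃ N, ‖S ^ (N+1)‖ < 1` (spectral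
radius `< 1`; what the cage lemma `exists_norm_pow_lt_one_of_cage` delivers). The adapted carrier produced
has period map `T^[N+1]`, linearisation `(S ^ (N+1), μ ^ (N+1))`, a shrunken radius on which the iterate is
`C¹` and keeps the `t`-axis invariant, the same reading map `π`, the same seeds, and a smallness radius
shrunk so that the first `N` iterates of `T` map it into the carrier's one — which converts the orbit
trichotomy of `T^[N+1]` into that of `T`, so the nakedness dictionary is inherited. [folklore] -/
theorem adaptedCombCarrier_of_cagedCombCarrier : (∃ (X : Type) (_ : TopologicalSpace X) (_ : ChartedSpace Literature.Geometry.Lorentzian.E3 X) (_ : IsManifold (𝓡 3) ((⊤ : ℕ∞) : WithTop ℕ∞) X) (_ : T2Space X) (_ : SecondCountableTopology X) (_ : ConnectedSpace X) (dstar : Literature.Geometry.Lorentzian.InitialDataSet (𝓡 3) X) (E : Type) (_ : NormedAddCommGroup E) (_ : NormedSpace ℝ E) (_ : CompleteSpace E) (T : E × ℝ → E × ℝ) (S : E →L[ℝ] E) (μ r₀ : ℝ) (π : Literature.Geometry.Lorentzian.InitialDataSet (𝓡 3) X → E × ℝ), dstar ∈ Literature.Geometry.Lorentzian.admissibleVacuumData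 X ∧ T 0 = 0 ∧ 0 < r₀ ∧ ContDiffOn ℝ 1 T (Metric.ball 0 r₀) ∧ HasFDerivAt T ((S.comp (ContinuousLinearMap.fst ℝ E ℝ)).prod (μ • ContinuousLinearMap.snd ℝ E ℝ)) 0 ∧ (∃ N : ℕ, ‖S ^ (N + 1)‖ < 1) ∧ 1 < μ ∧ (∀ t : ℝ, |t| < r₀ → (T ((0 : E), t)).1 = 0) ∧ π dstar = 0 ∧ (∀ F : EuclideanSpace ℝ (Fin 1) → Literature.Geometry.Lorentzian.InitialDataSet (𝓡 3) X, Literature.Geometry.Lorentzian.InitialDataSet.IsSmoothDataFamily 1 F → F 0 = dstar → (∀ c, F c ∈ Literature.Geometry.Lorentzian.admissibleVacuumData X) → (∃ C : Set X, IsCompact C ∧ ∀ c, ∀ x ∉ C, (F c).h.inner x = dstar.h.inner x ∧ (F c).k x = dstar.k x) → ∃ δ : ℝ, 0 < δ ∧ ContinuousOn (fun c ↦ π (F c)) (Metric.ball 0 δ)) ∧ ∀ r : ℝ, 0 < r → ∃ (σ₁ σ₂ ε₂ : ℝ) (G₁ G₂ : E × ℝ → ℝ), 0 < ε₂ ∧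 (0 < σ₁ ∧ σ₁ < r ∧ -r < σ₂ ∧ σ₂ < 0 ∧ (∃ r' : ℝ, 0 < r' ∧ ContDiffOn ℝ 1 G₁ (Metric.ball ((0 : E), σ₁) r') ∧ ContDiffOn ℝ 1 G₂ (Metric.ball ((0 : E), σ₂) r')) ∧ G₁ ((0 : E), σ₁) = 0 ∧ fderiv ℝ G₁ ((0 : E), σ₁) ((0 : E), (1 : ℝ)) ≠ 0 ∧ G₂ ((0 : E), σ₂) = 0 ∧ fderiv ℝ G₂ ((0 : E), σ₂) ((0 : E), (1 : ℝ)) ≠ 0) ∧ ∀ F : EuclideanSpace ℝ (Fin 1) → Literature.Geometry.Lorentzian.InitialDataSet (𝓡 3) X, Literature.Geometry.Lorentzian.InitialDataSet.IsSmoothDataFamily 1 F → F 0 = dstar → (∀ c, F c ∈ Literature.Geometry.Lorentzian.admissibleVacuumData X) → (∃ C : Set X, IsCompact C ∧ ∀ c, ∀ x ∉ C, (F c).h.inner x = dstar.h.inner x ∧ (F c).k x = dstar.k x) → ∃ δ : ℝ, 0 < δ ∧ ∀ c ∈ Metric.ball (0 : EuclideanSpace ℝ (Fin 1)) δ, ((∀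 n : ℕ, T^[n] (π (F c)) ∈ Metric.ball (0 : E × ℝ) ε₂) ∨ (∃ n : ℕ, T^[n] (π (F c)) ∈ Metric.ball ((0 : E), σ₁) ε₂ ∧ G₁ (T^[n] (π (F c))) = 0) ∨ (∃ n : ℕ, T^[n] (π (F c)) ∈ Metric.ball ((0 : E), σ₂) ε₂ ∧ G₂ (T^[n] (π (F c))) = 0)) → ∀ 𝒟 : Literature.Geometry.Lorentzian.VacuumCauchyDevelopment (F c), 𝒟.IsMaximal → ∀ [𝒟.metric.HasLeviCivita], ∃ (γ : ℝ → 𝒟.carrier) (dom : Set ℝ), (Literature.Geometry.Lorentzian.IsMaximalGeodesicOn 𝒟.metric.leviCivita γ dom ∧ (0 : ℝ) ∈ dom ∧ BddAbove dom ∧ (∀ t ∈ dom, 𝒟.metric.IsNull (Literature.Geometry.Lorentzian.velocity (𝓡 4) γ t) ∧ 𝒟.timeOrientation.IsFutureDirected (Literature.Geometry.Lorentzian.velocity (𝓡 4) γ t)) ∧ (∀ t ∈ dom, 0 ≤ t → (∃ (p : X) (δ' : ℝ → 𝒟.carrier) (s : Set ℝ), 𝒟.metric.IsNormalisedNullRayFrom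 𝒟.timeOrientation 𝒟.embed 𝒟.normal p δ' s ∧ ¬ BddAbove s ∧ γ t ∈ 𝒟.metric.chronologicalPast 𝒟.timeOrientation (δ' '' (s ∩ Set.Ici 0)))))) → (∃ (X : Type) (_ : TopologicalSpace X) (_ : ChartedSpace Literature.Geometry.Lorentzian.E3 X) (_ : IsManifold (𝓡 3) ((⊤ : ℕ∞) : WithTop ℕ∞) X) (_ : T2Space X) (_ : SecondCountableTopology X) (_ : ConnectedSpace X) (dstar : Literature.Geometry.Lorentzian.InitialDataSet (𝓡 3) X) (E : Type) (_ : NormedAddCommGroup E) (_ : NormedSpace ℝ E) (_ : CompleteSpace E) (T : E × ℝ → E × ℝ) (S : E →L[ℝ] E) (μ r₀ : ℝ) (π : Literature.Geometry.Lorentzian.InitialDataSet (𝓡 3) X → E × ℝ), dstar ∈ Literature.Geometry.Lorentzian.admissibleVacuumData X ∧ T 0 = 0 ∧ 0 < r₀ ∧ ContDiffOn ℝ 1 T (Metric.ball 0 r₀) ∧ HasFDerivAt T ((S.comp (ContinuousLinearMap.fst ℝ E ℝ)).prod (μ • ContinuousLinearMap.snd ℝ E ℝ)) 0 ∧ ‖S‖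 < 1 ∧ 1 < μ ∧ (∀ t : ℝ, |t| < r₀ → (T ((0 : E), t)).1 = 0) ∧ π dstar = 0 ∧ (∀ F : EuclideanSpace ℝ (Fin 1) → Literature.Geometry.Lorentzian.InitialDataSet (𝓡 3) X, Literature.Geometry.Lorentzian.InitialDataSet.IsSmoothDataFamily 1 F → F 0 = dstar → (∀ c, F c ∈ Literature.Geometry.Lorentzian.admissibleVacuumData X) → (∃ C : Set X, IsCompact C ∧ ∀ c, ∀ x ∉ C, (F c).h.inner x = dstar.h.inner x ∧ (F c).k x = dstar.k x) → ∃ δ : ℝ, 0 < δ ∧ ContinuousOn (fun c ↦ π (F c)) (Metric.ball 0 δ)) ∧ ∀ r : ℝ, 0 < r → ∃ (σ₁ σ₂ ε₂ : ℝ) (G₁ G₂ : E × ℝ → ℝ), 0 < ε₂ ∧ (0 < σ₁ ∧ σ₁ < r ∧ -r < σ₂ ∧ σ₂ < 0 ∧ (∃ r' : ℝ, 0 < r' ∧ ContDiffOn ℝ 1 G₁ (Metric.ball ((0 : E), σ₁) r') ∧ ContDiffOn ℝ 1 G₂ (Metric.ball ((0 : E), σ₂) r')) ∧ G₁ ((0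 : E), σ₁) = 0 ∧ fderiv ℝ G₁ ((0 : E), σ₁) ((0 : E), (1 : ℝ)) ≠ 0 ∧ G₂ ((0 : E), σ₂) = 0 ∧ fderiv ℝ G₂ ((0 : E), σ₂) ((0 : E), (1 : ℝ)) ≠ 0) ∧ ∀ F : EuclideanSpace ℝ (Fin 1) → Literature.Geometry.Lorentzian.InitialDataSet (𝓡 3) X, Literature.Geometry.Lorentzian.InitialDataSet.IsSmoothDataFamily 1 F → F 0 = dstar → (∀ c, F c ∈ Literature.Geometry.Lorentzian.admissibleVacuumData X) → (∃ C : Set X, IsCompact C ∧ ∀ c, ∀ x ∉ C, (F c).h.inner x = dstar.h.inner x ∧ (F c).k x = dstar.k x) → ∃ δ : ℝ, 0 < δ ∧ ∀ c ∈ Metric.ball (0 : EuclideanSpace ℝ (Fin 1)) δ, ((∀ n : ℕ, T^[n] (π (F c)) ∈ Metric.ball (0 : E × ℝ) ε₂) ∨ (∃ n : ℕ, T^[n] (π (F c)) ∈ Metric.ball ((0 : E), σ₁) ε₂ ∧ G₁ (T^[n] (π (F c))) = 0) ∨ (∃ n : ℕ, T^[n] (π (F c)) ∈ Metric.ball ((0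 : E), σ₂) ε₂ ∧ G₂ (T^[n] (π (F c))) = 0)) → ∀ 𝒟 : Literature.Geometry.Lorentzian.VacuumCauchyDevelopment (F c), 𝒟.IsMaximal → ∀ [𝒟.metric.HasLeviCivita], ∃ (γ : ℝ → 𝒟.carrier) (dom : Set ℝ), (Literature.Geometry.Lorentzian.IsMaximalGeodesicOn 𝒟.metric.leviCivita γ dom ∧ (0 : ℝ) ∈ dom ∧ BddAbove dom ∧ (∀ t ∈ dom, 𝒟.metric.IsNull (Literature.Geometry.Lorentzian.velocity (𝓡 4) γ t) ∧ 𝒟.timeOrientation.IsFutureDirected (Literature.Geometry.Lorentzian.velocity (𝓡 4) γ t)) ∧ (∀ t ∈ dom, 0 ≤ t → (∃ (p : X) (δ' : ℝ → 𝒟.carrier) (s : Set ℝ), 𝒟.metric.IsNormalisedNullRayFrom 𝒟.timeOrientation 𝒟.embed 𝒟.normal p δ' s ∧ ¬ BddAbove s ∧ γ t ∈ 𝒟.metric.chronologicalPast 𝒟.timeOrientation (δ' '' (s ∩ Set.Ici 0)))))) := by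
  rintro ⟨X, i₁, i₂, i₃, i₄, i₅, i₆, dstar, E, j₁, j₂, j₃, T, S, μ, r₀, π, hadm, hT0, hr₀, hT1, hTA, ⟨N, hSN⟩,
    hμ, haxis, hπ0, hcont, hseed⟩
  -- the number of steps of the new period map
  set M : ℕ := N + 1 with hM
  have hMpos : 0 < M := Nat.succ_pos N
  have hTc : ContinuousOn T (ball 0 r₀) := hT1.continuousOn
  -- a radius on which the first `M` iterates stay in the carrier's ball
  obtain ⟨r₁, hr₁, hr₁r₀, hmaps⟩ := exists_mapsTo_iterate_ball hTc hT0 hr₀ M r₀ hr₀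
  refine ⟨X, i₁, i₂, i₃, i₄, i₅, i₆, dstar, E, j₁, j₂, j₃, T^[M], S ^ M, μ ^ M, r₁, π, hadm, ?_, hr₁, ?_, ?_,
    hSN, one_lt_pow₀ hμ hMpos.ne', ?_, hπ0, hcont, ?_⟩
  · -- `T^[M] 0 = 0`
    exact iterate_fixed hT0 M
  · -- `C¹` on the shrunken ball
    have hCk : ∀ j ≤ M, ContDiffOn ℝ 1 T^[j] (ball (0 : E × ℝ) r₁) := by
      intro j
      induction j with
      | zero => intro _; exact contDiffOn_id
      | succ j ih =>
        intro hj
        have hj' : j ≤ M := (Nat.le_succ j).trans hj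
        rw [iterate_succ']
        exact hT1.comp (ih hj') (hmaps j hj')
    exact hCk M le_rfl
  · -- linearisation of the iterate
    have h := hTA.iterate hT0 M
    rwa [linearisation_pow] at h
  · -- the `t`-axis stays invariant under the iterate on the shrunken ball
    have hM' : M = N + 1 := rfl
    have hmapsN : ∀ j ≤ N, MapsTo T^[j] (ball (0 : E × ℝ) r₁) (ball 0 r₀) :=
      fun j hj ↦ hmaps j (hj.trans (Nat.le_succ N))
    intro t ht
    exact iterate_axis haxis hmapsN M le_rfl t ht
  · -- seeds and the nakedness dictionary, with the smallness radius shrunk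
    intro r hr
    obtain ⟨σ₁, σ₂, ε₂, G₁, G₂, hε₂, hseeds, hdict⟩ := hseed r hr
    obtain ⟨ε', hε', hε'ε₂, hsmall⟩ := exists_mapsTo_iterate_ball hTc hT0 hr₀ M ε₂ hε₂
    refine ⟨σ₁, σ₂, ε', G₁, G₂, hε', hseeds, ?_⟩
    intro F hF h0 hFadm hCpt
    obtain ⟨δ, hδ, hnk⟩ := hdict F hF h0 hFadm hCpt
    refine ⟨δ, hδ, fun c hc htri ↦ hnk c hc ?_⟩
    -- the trichotomy for `T^[M]` at radius `ε'` gives the trichotomy for `T` at radius `ε₂`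
    set p := π (F c) with hp
    rcases htri with hstay | ⟨n, hn, hG⟩ | ⟨n, hn, hG⟩
    · refine Or.inl fun m ↦ ?_
      have hdecomp : m = m % M + M * (m / M) := (Nat.mod_add_div m M).symm
      have hlt : m % M < M := Nat.mod_lt m hMpos
      have hq : T^[M * (m / M)] p ∈ ball (0 : E × ℝ) ε' := by
        rw [iterate_mul]; exact hstay (m / M)
      rw [hdecomp, iterate_add_apply]
      exact hsmall (m % M) hlt.le hq
    · refine Or.inr (Or.inl ⟨M * n, ?_, ?_⟩)
      · rw [iterate_mul]; exact ball_subset_ball hε'ε₂ hn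
      · rw [iterate_mul]; exact hG
    · refine Or.inr (Or.inr ⟨M * n, ?_, ?_⟩)
      · rw [iterate_mul]; exact ball_subset_ball hε'ε₂ hn
      · rw [iterate_mul]; exact hG

/-- **The crux from the caged comb line** (line `SketchIdeator1` reshaped; registered support statement
`laminatedThreshold_of_cagedComb`): adapted comb lemma (seat 1's registered `comb_lemma_adapted`, verbatim)
→ CAGED vacuum comb carrier (the adapted carrier with `‖S‖ < 1` weakened to `∃ N, ‖S ^ (N+1)‖ < 1`)
→ (naked developments are exceptional, `stub_nakedNotSettled` verbatim) → `LaminatedThreshold` by name.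
Proof: `adaptedCombCarrier_of_cagedCombCarrier`, then the landed `laminatedThreshold_of_adaptedComb_verbatim`.
Verbatim form (all hypotheses = the registered stub texts). [cite: GrebogiEtAl1983] [cite: McdonaldEtAl1985] -/
theorem laminatedThreshold_of_cagedComb_verbatim : (∀ (E : Type) [NormedAddCommGroup E] [NormedSpace ℝ E] [CompleteSpace E] (T : E × ℝ → E × ℝ) (S : E →L[ℝ] E) (μ r₀ : ℝ), T 0 = 0 → 0 < r₀ → ContDiffOn ℝ 1 T (Metric.ball 0 r₀) → HasFDerivAt T ((S.comp (ContinuousLinearMap.fst ℝ E ℝ)).prod (μ • ContinuousLinearMap.snd ℝ E ℝ)) 0 → ‖S‖ < 1 → 1 < μ → (∀ t : ℝ, |t| < r₀ → (T ((0 : E), t)).1 = 0) → ∃ r₁ : ℝ, 0 < r₁ ∧ ∀ (σ₁ σ₂ : ℝ) (G₁ G₂ : E × ℝ → ℝ), 0 < σ₁ ∧ σ₁ < r₁ ∧ -r₁ < σ₂ ∧ σ₂ < 0 ∧ (∃ r' : ℝ, 0 < r' ∧ ContDiffOn ℝ 1 G₁ (Metric.ball ((0 : E), σ₁) r') ∧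 ContDiffOn ℝ 1 G₂ (Metric.ball ((0 : E), σ₂) r')) ∧ G₁ ((0 : E), σ₁) = 0 ∧ fderiv ℝ G₁ ((0 : E), σ₁) ((0 : E), (1 : ℝ)) ≠ 0 ∧ G₂ ((0 : E), σ₂) = 0 ∧ fderiv ℝ G₂ ((0 : E), σ₂) ((0 : E), (1 : ℝ)) ≠ 0 → ∀ ε : ℝ, 0 < ε → ∃ ρ : ℝ, 0 < ρ ∧ ∃ (Φ : E × ℝ → ℝ) (K : Set ℝ), Φ 0 = 0 ∧ (0 : ℝ) ∈ K ∧ (∀ η : ℝ, 0 < η → (K ∩ Set.Ioo (0 - η) 0).Nonempty ∧ (K ∩ Set.Ioo 0 (0 + η)).Nonempty) ∧ ContinuousOn Φ (Metric.ball 0 ρ) ∧ ∀ p ∈ Metric.ball (0 : E × ℝ) ρ, Φ p ∈ K → ((∀ n : ℕ, T^[n] p ∈ Metric.ball (0 : E × ℝ) ε) ∨ (∃ n : ℕ, T^[n] p ∈ Metric.ball ((0 : E), σ₁) ε ∧ G₁ (T^[n] p) = 0) ∨ (∃ n : ℕ, T^[n] p ∈ Metric.ball ((0 : E), σ₂) ε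 ∧ G₂ (T^[n] p) = 0))) → (∃ (X : Type) (_ : TopologicalSpace X) (_ : ChartedSpace Literature.Geometry.Lorentzian.E3 X) (_ : IsManifold (𝓡 3) ((⊤ : ℕ∞) : WithTop ℕ∞) X) (_ : T2Space X) (_ : SecondCountableTopology X) (_ : ConnectedSpace X) (dstar : Literature.Geometry.Lorentzian.InitialDataSet (𝓡 3) X) (E : Type) (_ : NormedAddCommGroup E) (_ : NormedSpace ℝ E) (_ : CompleteSpace E) (T : E × ℝ → E × ℝ) (S : E →L[ℝ] E) (μ r₀ : ℝ) (π : Literature.Geometry.Lorentzian.InitialDataSet (𝓡 3) X → E × ℝ), dstar ∈ Literature.Geometry.Lorentzian.admissibleVacuumData X ∧ T 0 = 0 ∧ 0 < r₀ ∧ ContDiffOn ℝ 1 T (Metric.ball 0 r₀) ∧ HasFDerivAt T ((S.comp (ContinuousLinearMap.fst ℝ E ℝ)).prod (μ • ContinuousLinearMap.snd ℝ E ℝ)) 0 ∧ (∃ N : ℕ, ‖S ^ (N + 1)‖ < 1) ∧ 1 < μ ∧ (∀ t : ℝ, |t| < r₀ → (T ((0 : E), t)).1 = 0) ∧ π dstar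 = 0 ∧ (∀ F : EuclideanSpace ℝ (Fin 1) → Literature.Geometry.Lorentzian.InitialDataSet (𝓡 3) X, Literature.Geometry.Lorentzian.InitialDataSet.IsSmoothDataFamily 1 F → F 0 = dstar → (∀ c, F c ∈ Literature.Geometry.Lorentzian.admissibleVacuumData X) → (∃ C : Set X, IsCompact C ∧ ∀ c, ∀ x ∉ C, (F c).h.inner x = dstar.h.inner x ∧ (F c).k x = dstar.k x) → ∃ δ : ℝ, 0 < δ ∧ ContinuousOn (fun c ↦ π (F c)) (Metric.ball 0 δ)) ∧ ∀ r : ℝ, 0 < r → ∃ (σ₁ σ₂ ε₂ : ℝ) (G₁ G₂ : E × ℝ → ℝ), 0 < ε₂ ∧ (0 < σ₁ ∧ σ₁ < r ∧ -r < σ₂ ∧ σ₂ < 0 ∧ (∃ r' : ℝ, 0 < r' ∧ ContDiffOn ℝ 1 G₁ (Metric.ball ((0 : E), σ₁) r') ∧ ContDiffOn ℝ 1 G₂ (Metric.ball ((0 : E), σ₂) r')) ∧ G₁ ((0 : E), σ₁) = 0 ∧ fderiv ℝ G₁ ((0 : E), σ₁) ((0 : E), (1 : ℝ)) ≠ 0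 ∧ G₂ ((0 : E), σ₂) = 0 ∧ fderiv ℝ G₂ ((0 : E), σ₂) ((0 : E), (1 : ℝ)) ≠ 0) ∧ ∀ F : EuclideanSpace ℝ (Fin 1) → Literature.Geometry.Lorentzian.InitialDataSet (𝓡 3) X, Literature.Geometry.Lorentzian.InitialDataSet.IsSmoothDataFamily 1 F → F 0 = dstar → (∀ c, F c ∈ Literature.Geometry.Lorentzian.admissibleVacuumData X) → (∃ C : Set X, IsCompact C ∧ ∀ c, ∀ x ∉ C, (F c).h.inner x = dstar.h.inner x ∧ (F c).k x = dstar.k x) → ∃ δ : ℝ, 0 < δ ∧ ∀ c ∈ Metric.ball (0 : EuclideanSpace ℝ (Fin 1)) δ, ((∀ n : ℕ, T^[n] (π (F c)) ∈ Metric.ball (0 : E × ℝ) ε₂) ∨ (∃ n : ℕ, T^[n] (π (F c)) ∈ Metric.ball ((0 : E), σ₁) ε₂ ∧ G₁ (T^[n] (π (F c))) = 0) ∨ (∃ n : ℕ, T^[n] (π (F c)) ∈ Metric.ball ((0 : E), σ₂) ε₂ ∧ G₂ (T^[n] (π (F c))) = 0)) → ∀ 𝒟 : Literature.Geometry.Lorentzian.VacuumCauchyDevelopment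 (F c), 𝒟.IsMaximal → ∀ [𝒟.metric.HasLeviCivita], ∃ (γ : ℝ → 𝒟.carrier) (dom : Set ℝ), (Literature.Geometry.Lorentzian.IsMaximalGeodesicOn 𝒟.metric.leviCivita γ dom ∧ (0 : ℝ) ∈ dom ∧ BddAbove dom ∧ (∀ t ∈ dom, 𝒟.metric.IsNull (Literature.Geometry.Lorentzian.velocity (𝓡 4) γ t) ∧ 𝒟.timeOrientation.IsFutureDirected (Literature.Geometry.Lorentzian.velocity (𝓡 4) γ t)) ∧ (∀ t ∈ dom, 0 ≤ t → (∃ (p : X) (δ' : ℝ → 𝒟.carrier) (s : Set ℝ), 𝒟.metric.IsNormalisedNullRayFrom 𝒟.timeOrientation 𝒟.embed 𝒟.normal p δ' s ∧ ¬ BddAbove s ∧ γ t ∈ 𝒟.metric.chronologicalPast 𝒟.timeOrientation (δ' '' (s ∩ Set.Ici 0)))))) → (∀ (X : Type) [TopologicalSpace X] [ChartedSpace Literature.Geometry.Lorentzian.E3 X] [IsManifold (𝓡 3) ((⊤ : ℕ∞) : WithTop ℕ∞) X] [T2Space X] [SecondCountableTopology X] [ConnectedSpace X], ∀ D ∈ Literature.Geometry.Lorentzian.admissibleVacuumData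 X, ∀ 𝒟 : Literature.Geometry.Lorentzian.VacuumCauchyDevelopment D, 𝒟.IsMaximal → (∀ [𝒟.metric.HasLeviCivita], ∃ (γ : ℝ → 𝒟.carrier) (dom : Set ℝ), (Literature.Geometry.Lorentzian.IsMaximalGeodesicOn 𝒟.metric.leviCivita γ dom ∧ (0 : ℝ) ∈ dom ∧ BddAbove dom ∧ (∀ t ∈ dom, 𝒟.metric.IsNull (Literature.Geometry.Lorentzian.velocity (𝓡 4) γ t) ∧ 𝒟.timeOrientation.IsFutureDirected (Literature.Geometry.Lorentzian.velocity (𝓡 4) γ t)) ∧ (∀ t ∈ dom, 0 ≤ t → (∃ (p : X) (δ' : ℝ → 𝒟.carrier) (s : Set ℝ), 𝒟.metric.IsNormalisedNullRayFrom 𝒟.timeOrientation 𝒟.embed 𝒟.normal p δ' s ∧ ¬ BddAbove s ∧ γ t ∈ 𝒟.metric.chronologicalPast 𝒟.timeOrientation (δ' '' (s ∩ Set.Ici 0)))))) → ¬ (Summit.FinalStateConjecture.HasCompleteNullInfinity 𝒟.toCauchyDevelopment ∧ ∃ (O : Set 𝒟.carrier) (d : Literature.Geometry.Lorentzian.FinalStateDecomposition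 𝒟.toSpacetime O 2), (∀ i, Literature.Geometry.Lorentzian.Kerr.IsSubextremal (d.mass i) (d.spin i)) ∧ O = Summit.FinalStateConjecture.exteriorOf 𝒟.toCauchyDevelopment d.charted ∧ Summit.FinalStateConjecture.RaysStayInClosure 𝒟.toCauchyDevelopment O ∧ Summit.FinalStateConjecture.HasExhaustiveCharts d ∧ Summit.FinalStateConjecture.IsFutureOriented d)) → Summit.FinalStateConjecture.FinalStateConjecture.Theses.LaminatedThreshold.LaminatedThreshold :=
  fun hL hC hN ↦ laminatedThreshold_of_adaptedComb_verbatim hL (adaptedCombCarrier_of_cagedCombCarrier hC) hN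

/-- **The crux from the caged comb line** (registered support statement `laminatedThreshold_of_cagedComb`; the
same statement with the tree's abbreviations `DataEmbedding.IsVisibleIncompleteNullRay` — Iff.rfl-equal to the
inlined naked-ray clause — and `ClusterCompleteness.SettlesT2` — the inlined settled clause): adapted comb lemma →
caged vacuum comb carrier → (naked developments are exceptional) → `LaminatedThreshold`.
[cite: GrebogiEtAl1983] [cite: McdonaldEtAl1985] -/
theorem laminatedThreshold_of_cagedComb : (∀ (E : Type) [NormedAddCommGroup E] [NormedSpace ℝ E] [CompleteSpace E] (T : E × ℝ → E × ℝ) (S : E →L[ℝ] E) (μ r₀ : ℝ), T 0 = 0 → 0 < r₀ → ContDiffOn ℝ 1 T (Metric.ball 0 r₀) → HasFDerivAt T ((S.comp (ContinuousLinearMap.fst ℝ E ℝ)).prod (μ • ContinuousLinearMap.snd ℝ E ℝ)) 0 → ‖S‖ < 1 → 1 < μ → (∀ t : ℝ, |t| < r₀ → (T ((0 : E), t)).1 = 0) → ∃ r₁ : ℝ, 0 < r₁ ∧ ∀ (σ₁ σ₂ : ℝ) (G₁ G₂ : E × ℝ → ℝ), 0 < σ₁ ∧ σ₁ < r₁ ∧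 -r₁ < σ₂ ∧ σ₂ < 0 ∧ (∃ r' : ℝ, 0 < r' ∧ ContDiffOn ℝ 1 G₁ (Metric.ball ((0 : E), σ₁) r') ∧ ContDiffOn ℝ 1 G₂ (Metric.ball ((0 : E), σ₂) r')) ∧ G₁ ((0 : E), σ₁) = 0 ∧ fderiv ℝ G₁ ((0 : E), σ₁) ((0 : E), (1 : ℝ)) ≠ 0 ∧ G₂ ((0 : E), σ₂) = 0 ∧ fderiv ℝ G₂ ((0 : E), σ₂) ((0 : E), (1 : ℝ)) ≠ 0 → ∀ ε : ℝ, 0 < ε → ∃ ρ : ℝ, 0 < ρ ∧ ∃ (Φ : E × ℝ → ℝ) (K : Set ℝ), Φ 0 = 0 ∧ (0 : ℝ) ∈ K ∧ (∀ η : ℝ, 0 < η → (K ∩ Set.Ioo (0 - η) 0).Nonempty ∧ (K ∩ Set.Ioo 0 (0 + η)).Nonempty) ∧ ContinuousOn Φ (Metric.ball 0 ρ) ∧ ∀ p ∈ Metric.ball (0 : E × ℝ) ρ, Φ p ∈ K → ((∀ n : ℕ, T^[n] p ∈ Metric.ball (0 : E × ℝ) ε) ∨ (∃ n : ℕ, T^[n]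 p ∈ Metric.ball ((0 : E), σ₁) ε ∧ G₁ (T^[n] p) = 0) ∨ (∃ n : ℕ, T^[n] p ∈ Metric.ball ((0 : E), σ₂) ε ∧ G₂ (T^[n] p) = 0))) → (∃ (X : Type) (_ : TopologicalSpace X) (_ : ChartedSpace E3 X) (_ : IsManifold (𝓡 3) ((⊤ : ℕ∞) : WithTop ℕ∞) X) (_ : T2Space X) (_ : SecondCountableTopology X) (_ : ConnectedSpace X) (dstar : InitialDataSet (𝓡 3) X) (E : Type) (_ : NormedAddCommGroup E) (_ : NormedSpace ℝ E) (_ : CompleteSpace E) (T : E × ℝ → E × ℝ) (S : E →L[ℝ] E) (μ r₀ : ℝ) (π : InitialDataSet (𝓡 3) X → E × ℝ), dstar ∈ admissibleVacuumData X ∧ T 0 = 0 ∧ 0 < r₀ ∧ ContDiffOn ℝ 1 T (Metric.ball 0 r₀) ∧ HasFDerivAt T ((S.comp (ContinuousLinearMap.fst ℝ E ℝ)).prod (μ • ContinuousLinearMap.snd ℝ E ℝ)) 0 ∧ (∃ N : ℕ, ‖S ^ (N + 1)‖ < 1) ∧ 1 < μ ∧ (∀ t : ℝ, |t| < r₀ →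 (T ((0 : E), t)).1 = 0) ∧ π dstar = 0 ∧ (∀ F : EuclideanSpace ℝ (Fin 1) → InitialDataSet (𝓡 3) X, InitialDataSet.IsSmoothDataFamily 1 F → F 0 = dstar → (∀ c, F c ∈ admissibleVacuumData X) → (∃ C : Set X, IsCompact C ∧ ∀ c, ∀ x ∉ C, (F c).h.inner x = dstar.h.inner x ∧ (F c).k x = dstar.k x) → ∃ δ : ℝ, 0 < δ ∧ ContinuousOn (fun c ↦ π (F c)) (Metric.ball 0 δ)) ∧ ∀ r : ℝ, 0 < r → ∃ (σ₁ σ₂ ε₂ : ℝ) (G₁ G₂ : E × ℝ → ℝ), 0 < ε₂ ∧ (0 < σ₁ ∧ σ₁ < r ∧ -r < σ₂ ∧ σ₂ < 0 ∧ (∃ r' : ℝ, 0 < r' ∧ ContDiffOn ℝ 1 G₁ (Metric.ball ((0 : E), σ₁) r') ∧ ContDiffOn ℝ 1 G₂ (Metric.ball ((0 : E), σ₂) r')) ∧ G₁ ((0 : E), σ₁) = 0 ∧ fderiv ℝ G₁ ((0 : E), σ₁) ((0 : E), (1 : ℝ)) ≠ 0 ∧ G₂ ((0 : E), σ₂) =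 0 ∧ fderiv ℝ G₂ ((0 : E), σ₂) ((0 : E), (1 : ℝ)) ≠ 0) ∧ ∀ F : EuclideanSpace ℝ (Fin 1) → InitialDataSet (𝓡 3) X, InitialDataSet.IsSmoothDataFamily 1 F → F 0 = dstar → (∀ c, F c ∈ admissibleVacuumData X) → (∃ C : Set X, IsCompact C ∧ ∀ c, ∀ x ∉ C, (F c).h.inner x = dstar.h.inner x ∧ (F c).k x = dstar.k x) → ∃ δ : ℝ, 0 < δ ∧ ∀ c ∈ Metric.ball (0 : EuclideanSpace ℝ (Fin 1)) δ, ((∀ n : ℕ, T^[n] (π (F c)) ∈ Metric.ball (0 : E × ℝ) ε₂) ∨ (∃ n : ℕ, T^[n] (π (F c)) ∈ Metric.ball ((0 : E), σ₁) ε₂ ∧ G₁ (T^[n] (π (F c))) = 0) ∨ (∃ n : ℕ, T^[n] (π (F c)) ∈ Metric.ball ((0 : E), σ₂) ε₂ ∧ G₂ (T^[n] (π (F c))) = 0)) → ∀ 𝒟 : VacuumCauchyDevelopment (F c), 𝒟.IsMaximal → ∀ [𝒟.metric.HasLeviCivita], ∃ (γ : ℝ → 𝒟.carrier) (dom : Set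 ℝ), 𝒟.IsVisibleIncompleteNullRay γ dom) → (∀ (X : Type) [TopologicalSpace X] [ChartedSpace E3 X] [IsManifold (𝓡 3) ((⊤ : ℕ∞) : WithTop ℕ∞) X] [T2Space X] [SecondCountableTopology X] [ConnectedSpace X], ∀ D ∈ admissibleVacuumData X, ∀ 𝒟 : VacuumCauchyDevelopment D, 𝒟.IsMaximal → (∀ [𝒟.metric.HasLeviCivita], ∃ (γ : ℝ → 𝒟.carrier) (dom : Set ℝ), 𝒟.IsVisibleIncompleteNullRay γ dom) → ¬ Summit.FinalStateConjecture.FinalStateConjecture.Theorems.ClusterCompleteness.SettlesT2 𝒟) → Summit.FinalStateConjecture.FinalStateConjecture.Theses.LaminatedThreshold.LaminatedThreshold :=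
  fun hL hC hN ↦ laminatedThreshold_of_cagedComb_verbatim hL hC hN

/-- **An explicitly caged vacuum comb carrier is a caged one.** Here the complement `E` of the unstable
direction carries the cage data of idea card `equivariant-cage`: an idempotent `P` (symmetrisation)
commuting with the linearised period map `S`, an `S`-invariant stable subspace `Vs ⊇ range P` fixed by `P`
on which `S` contracts by `θ`, and `θ`-contraction of the non-symmetric part `ker P`, `0 ≤ θ < 1`; the cage
lemma `exists_norm_pow_lt_one_of_cage` turns this into eventual contraction `∃ N, ‖S ^ (N+1)‖ < 1`, all other
clauses being carried over verbatim. [folklore] -/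
theorem cagedCombCarrier_of_explicitCage : (∃ (X : Type) (_ : TopologicalSpace X) (_ : ChartedSpace Literature.Geometry.Lorentzian.E3 X) (_ : IsManifold (𝓡 3) ((⊤ : ℕ∞) : WithTop ℕ∞) X) (_ : T2Space X) (_ : SecondCountableTopology X) (_ : ConnectedSpace X) (dstar : Literature.Geometry.Lorentzian.InitialDataSet (𝓡 3) X) (E : Type) (_ : NormedAddCommGroup E) (_ : NormedSpace ℝ E) (_ : CompleteSpace E) (T : E × ℝ → E × ℝ) (S : E →L[ℝ] E) (μ r₀ : ℝ) (π : Literature.Geometry.Lorentzian.InitialDataSet (𝓡 3) X → E × ℝ) (P : E →L[ℝ] E) (Vs : Submodule ℝ E) (θ : ℝ), dstar ∈ Literature.Geometry.Lorentzian.admissibleVacuumData X ∧ T 0 = 0 ∧ 0 < r₀ ∧ ContDiffOn ℝ 1 T (Metric.ball 0 r₀) ∧ HasFDerivAt T ((S.comp (ContinuousLinearMap.fst ℝ E ℝ)).prod (μ • ContinuousLinearMap.snd ℝ E ℝ)) 0 ∧ (0 ≤ θ ∧ θ < 1 ∧ (∀ x : E, S (P x) = P (S x)) ∧ (∀ x :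 E, P x ∈ Vs) ∧ (∀ v ∈ Vs, P v = v) ∧ (∀ v ∈ Vs, S v ∈ Vs) ∧ (∀ v ∈ Vs, ‖S v‖ ≤ θ * ‖v‖) ∧ (∀ w : E, P w = 0 → ‖S w‖ ≤ θ * ‖w‖)) ∧ 1 < μ ∧ (∀ t : ℝ, |t| < r₀ → (T ((0 : E), t)).1 = 0) ∧ π dstar = 0 ∧ (∀ F : EuclideanSpace ℝ (Fin 1) → Literature.Geometry.Lorentzian.InitialDataSet (𝓡 3) X, Literature.Geometry.Lorentzian.InitialDataSet.IsSmoothDataFamily 1 F → F 0 = dstar → (∀ c, F c ∈ Literature.Geometry.Lorentzian.admissibleVacuumData X) → (∃ C : Set X, IsCompact C ∧ ∀ c, ∀ x ∉ C, (F c).h.inner x = dstar.h.inner x ∧ (F c).k x = dstar.k x) → ∃ δ : ℝ, 0 < δ ∧ ContinuousOn (fun c ↦ π (F c)) (Metric.ball 0 δ)) ∧ ∀ r : ℝ, 0 < r → ∃ (σ₁ σ₂ ε₂ : ℝ) (G₁ G₂ : E × ℝ → ℝ), 0 < ε₂ ∧ (0 < σ₁ ∧ σ₁ < r ∧ -r <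 σ₂ ∧ σ₂ < 0 ∧ (∃ r' : ℝ, 0 < r' ∧ ContDiffOn ℝ 1 G₁ (Metric.ball ((0 : E), σ₁) r') ∧ ContDiffOn ℝ 1 G₂ (Metric.ball ((0 : E), σ₂) r')) ∧ G₁ ((0 : E), σ₁) = 0 ∧ fderiv ℝ G₁ ((0 : E), σ₁) ((0 : E), (1 : ℝ)) ≠ 0 ∧ G₂ ((0 : E), σ₂) = 0 ∧ fderiv ℝ G₂ ((0 : E), σ₂) ((0 : E), (1 : ℝ)) ≠ 0) ∧ ∀ F : EuclideanSpace ℝ (Fin 1) → Literature.Geometry.Lorentzian.InitialDataSet (𝓡 3) X, Literature.Geometry.Lorentzian.InitialDataSet.IsSmoothDataFamily 1 F → F 0 = dstar → (∀ c, F c ∈ Literature.Geometry.Lorentzian.admissibleVacuumData X) → (∃ C : Set X, IsCompact C ∧ ∀ c, ∀ x ∉ C, (F c).h.inner x = dstar.h.inner x ∧ (F c).k x = dstar.k x) → ∃ δ : ℝ, 0 < δ ∧ ∀ c ∈ Metric.ball (0 : EuclideanSpace ℝ (Fin 1)) δ, ((∀ n : ℕ, T^[n] (π (F c)) ∈ Metric.ball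 (0 : E × ℝ) ε₂) ∨ (∃ n : ℕ, T^[n] (π (F c)) ∈ Metric.ball ((0 : E), σ₁) ε₂ ∧ G₁ (T^[n] (π (F c))) = 0) ∨ (∃ n : ℕ, T^[n] (π (F c)) ∈ Metric.ball ((0 : E), σ₂) ε₂ ∧ G₂ (T^[n] (π (F c))) = 0)) → ∀ 𝒟 : Literature.Geometry.Lorentzian.VacuumCauchyDevelopment (F c), 𝒟.IsMaximal → ∀ [𝒟.metric.HasLeviCivita], ∃ (γ : ℝ → 𝒟.carrier) (dom : Set ℝ), (Literature.Geometry.Lorentzian.IsMaximalGeodesicOn 𝒟.metric.leviCivita γ dom ∧ (0 : ℝ) ∈ dom ∧ BddAbove dom ∧ (∀ t ∈ dom, 𝒟.metric.IsNull (Literature.Geometry.Lorentzian.velocity (𝓡 4) γ t) ∧ 𝒟.timeOrientation.IsFutureDirected (Literature.Geometry.Lorentzian.velocity (𝓡 4) γ t)) ∧ (∀ t ∈ dom, 0 ≤ t → (∃ (p : X) (δ' : ℝ → 𝒟.carrier) (s : Set ℝ), 𝒟.metric.IsNormalisedNullRayFrom 𝒟.timeOrientation 𝒟.embed 𝒟.normal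 p δ' s ∧ ¬ BddAbove s ∧ γ t ∈ 𝒟.metric.chronologicalPast 𝒟.timeOrientation (δ' '' (s ∩ Set.Ici 0)))))) → (∃ (X : Type) (_ : TopologicalSpace X) (_ : ChartedSpace Literature.Geometry.Lorentzian.E3 X) (_ : IsManifold (𝓡 3) ((⊤ : ℕ∞) : WithTop ℕ∞) X) (_ : T2Space X) (_ : SecondCountableTopology X) (_ : ConnectedSpace X) (dstar : Literature.Geometry.Lorentzian.InitialDataSet (𝓡 3) X) (E : Type) (_ : NormedAddCommGroup E) (_ : NormedSpace ℝ E) (_ : CompleteSpace E) (T : E × ℝ → E × ℝ) (S : E →L[ℝ] E) (μ r₀ : ℝ) (π : Literature.Geometry.Lorentzian.InitialDataSet (𝓡 3) X → E × ℝ), dstar ∈ Literature.Geometry.Lorentzian.admissibleVacuumData X ∧ T 0 = 0 ∧ 0 < r₀ ∧ ContDiffOn ℝ 1 T (Metric.ball 0 r₀) ∧ HasFDerivAt T ((S.comp (ContinuousLinearMap.fst ℝ E ℝ)).prod (μ • ContinuousLinearMap.snd ℝ E ℝ)) 0 ∧ (∃ N : ℕ, ‖S ^ (N + 1)‖ < 1)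 ∧ 1 < μ ∧ (∀ t : ℝ, |t| < r₀ → (T ((0 : E), t)).1 = 0) ∧ π dstar = 0 ∧ (∀ F : EuclideanSpace ℝ (Fin 1) → Literature.Geometry.Lorentzian.InitialDataSet (𝓡 3) X, Literature.Geometry.Lorentzian.InitialDataSet.IsSmoothDataFamily 1 F → F 0 = dstar → (∀ c, F c ∈ Literature.Geometry.Lorentzian.admissibleVacuumData X) → (∃ C : Set X, IsCompact C ∧ ∀ c, ∀ x ∉ C, (F c).h.inner x = dstar.h.inner x ∧ (F c).k x = dstar.k x) → ∃ δ : ℝ, 0 < δ ∧ ContinuousOn (fun c ↦ π (F c)) (Metric.ball 0 δ)) ∧ ∀ r : ℝ, 0 < r → ∃ (σ₁ σ₂ ε₂ : ℝ) (G₁ G₂ : E × ℝ → ℝ), 0 < ε₂ ∧ (0 < σ₁ ∧ σ₁ < r ∧ -r < σ₂ ∧ σ₂ < 0 ∧ (∃ r' : ℝ, 0 < r' ∧ ContDiffOn ℝ 1 G₁ (Metric.ball ((0 : E), σ₁) r') ∧ ContDiffOn ℝ 1 G₂ (Metric.ball ((0 : E), σ₂) r')) ∧ G₁ ((0 : E),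 σ₁) = 0 ∧ fderiv ℝ G₁ ((0 : E), σ₁) ((0 : E), (1 : ℝ)) ≠ 0 ∧ G₂ ((0 : E), σ₂) = 0 ∧ fderiv ℝ G₂ ((0 : E), σ₂) ((0 : E), (1 : ℝ)) ≠ 0) ∧ ∀ F : EuclideanSpace ℝ (Fin 1) → Literature.Geometry.Lorentzian.InitialDataSet (𝓡 3) X, Literature.Geometry.Lorentzian.InitialDataSet.IsSmoothDataFamily 1 F → F 0 = dstar → (∀ c, F c ∈ Literature.Geometry.Lorentzian.admissibleVacuumData X) → (∃ C : Set X, IsCompact C ∧ ∀ c, ∀ x ∉ C, (F c).h.inner x = dstar.h.inner x ∧ (F c).k x = dstar.k x) → ∃ δ : ℝ, 0 < δ ∧ ∀ c ∈ Metric.ball (0 : EuclideanSpace ℝ (Fin 1)) δ, ((∀ n : ℕ, T^[n] (π (F c)) ∈ Metric.ball (0 : E × ℝ) ε₂) ∨ (∃ n : ℕ, T^[n] (π (F c)) ∈ Metric.ball ((0 : E), σ₁) ε₂ ∧ G₁ (T^[n] (π (F c))) = 0) ∨ (∃ n : ℕ, T^[n] (π (F c)) ∈ Metric.ball ((0 :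 E), σ₂) ε₂ ∧ G₂ (T^[n] (π (F c))) = 0)) → ∀ 𝒟 : Literature.Geometry.Lorentzian.VacuumCauchyDevelopment (F c), 𝒟.IsMaximal → ∀ [𝒟.metric.HasLeviCivita], ∃ (γ : ℝ → 𝒟.carrier) (dom : Set ℝ), (Literature.Geometry.Lorentzian.IsMaximalGeodesicOn 𝒟.metric.leviCivita γ dom ∧ (0 : ℝ) ∈ dom ∧ BddAbove dom ∧ (∀ t ∈ dom, 𝒟.metric.IsNull (Literature.Geometry.Lorentzian.velocity (𝓡 4) γ t) ∧ 𝒟.timeOrientation.IsFutureDirected (Literature.Geometry.Lorentzian.velocity (𝓡 4) γ t)) ∧ (∀ t ∈ dom, 0 ≤ t → (∃ (p : X) (δ' : ℝ → 𝒟.carrier) (s : Set ℝ), 𝒟.metric.IsNormalisedNullRayFrom 𝒟.timeOrientation 𝒟.embed 𝒟.normal p δ' s ∧ ¬ BddAbove s ∧ γ t ∈ 𝒟.metric.chronologicalPast 𝒟.timeOrientation (δ' '' (s ∩ Set.Ici 0)))))) := by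
  rintro ⟨X, i₁, i₂, i₃, i₄, i₅, i₆, dstar, E, j₁, j₂, j₃, T, S, μ, r₀, π, P, Vs, θ, hadm, hT0, hr₀, hT1, hTA,
    ⟨hθ0, hθ1, hcomm, hPV, hVP, hSV, hSVs, hSW⟩, hμ, haxis, hπ0, hcont, hseed⟩
  exact ⟨X, i₁, i₂, i₃, i₄, i₅, i₆, dstar, E, j₁, j₂, j₃, T, S, μ, r₀, π, hadm, hT0, hr₀, hT1, hTA,
    exists_norm_pow_lt_one_of_cage S P Vs θ hθ0 hθ1 hcomm hPV hVP hSV hSVs hSW, hμ, haxis, hπ0, hcont, hseed⟩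

/-- **The crux from an explicitly caged comb carrier** (verbatim form): adapted comb lemma → explicitly caged
vacuum comb carrier → (naked developments are exceptional) → `LaminatedThreshold` by name. [folklore] -/
theorem laminatedThreshold_of_explicitCage_verbatim : (∀ (E : Type) [NormedAddCommGroup E] [NormedSpace ℝ E] [CompleteSpace E] (T : E × ℝ → E × ℝ) (S : E →L[ℝ] E) (μ r₀ : ℝ), T 0 = 0 → 0 < r₀ → ContDiffOn ℝ 1 T (Metric.ball 0 r₀) → HasFDerivAt T ((S.comp (ContinuousLinearMap.fst ℝ E ℝ)).prod (μ • ContinuousLinearMap.snd ℝ E ℝ)) 0 → ‖S‖ < 1 → 1 < μ → (∀ t : ℝ, |t| < r₀ → (T ((0 : E), t)).1 = 0) → ∃ r₁ : ℝ, 0 < r₁ ∧ ∀ (σ₁ σ₂ : ℝ) (G₁ G₂ : E × ℝ → ℝ), 0 < σ₁ ∧ σ₁ < r₁ ∧ -r₁ < σ₂ ∧ σ₂ < 0 ∧ (∃ r' : ℝ, 0 < r' ∧ ContDiffOn ℝ 1 G₁ (Metric.ball ((0 : E), σ₁) r') ∧ ContDiffOn ℝ 1 G₂ (Metric.ball ((0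 : E), σ₂) r')) ∧ G₁ ((0 : E), σ₁) = 0 ∧ fderiv ℝ G₁ ((0 : E), σ₁) ((0 : E), (1 : ℝ)) ≠ 0 ∧ G₂ ((0 : E), σ₂) = 0 ∧ fderiv ℝ G₂ ((0 : E), σ₂) ((0 : E), (1 : ℝ)) ≠ 0 → ∀ ε : ℝ, 0 < ε → ∃ ρ : ℝ, 0 < ρ ∧ ∃ (Φ : E × ℝ → ℝ) (K : Set ℝ), Φ 0 = 0 ∧ (0 : ℝ) ∈ K ∧ (∀ η : ℝ, 0 < η → (K ∩ Set.Ioo (0 - η) 0).Nonempty ∧ (K ∩ Set.Ioo 0 (0 + η)).Nonempty) ∧ ContinuousOn Φ (Metric.ball 0 ρ) ∧ ∀ p ∈ Metric.ball (0 : E × ℝ) ρ, Φ p ∈ K → ((∀ n : ℕ, T^[n] p ∈ Metric.ball (0 : E × ℝ) ε) ∨ (∃ n : ℕ, T^[n] p ∈ Metric.ball ((0 : E), σ₁) ε ∧ G₁ (T^[n] p) = 0) ∨ (∃ n : ℕ, T^[n] p ∈ Metric.ball ((0 : E), σ₂) ε ∧ G₂ (T^[n] p) = 0))) → (∃ (X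 : Type) (_ : TopologicalSpace X) (_ : ChartedSpace Literature.Geometry.Lorentzian.E3 X) (_ : IsManifold (𝓡 3) ((⊤ : ℕ∞) : WithTop ℕ∞) X) (_ : T2Space X) (_ : SecondCountableTopology X) (_ : ConnectedSpace X) (dstar : Literature.Geometry.Lorentzian.InitialDataSet (𝓡 3) X) (E : Type) (_ : NormedAddCommGroup E) (_ : NormedSpace ℝ E) (_ : CompleteSpace E) (T : E × ℝ → E × ℝ) (S : E →L[ℝ] E) (μ r₀ : ℝ) (π : Literature.Geometry.Lorentzian.InitialDataSet (𝓡 3) X → E × ℝ) (P : E →L[ℝ] E) (Vs : Submodule ℝ E) (θ : ℝ), dstar ∈ Literature.Geometry.Lorentzian.admissibleVacuumData X ∧ T 0 = 0 ∧ 0 < r₀ ∧ ContDiffOn ℝ 1 T (Metric.ball 0 r₀) ∧ HasFDerivAt T ((S.comp (ContinuousLinearMap.fst ℝ E ℝ)).prod (μ • ContinuousLinearMap.snd ℝ E ℝ)) 0 ∧ (0 ≤ θ ∧ θ < 1 ∧ (∀ x : E, S (P x) = P (S x)) ∧ (∀ x : E, P x ∈ Vs) ∧ (∀ v ∈ Vs,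 P v = v) ∧ (∀ v ∈ Vs, S v ∈ Vs) ∧ (∀ v ∈ Vs, ‖S v‖ ≤ θ * ‖v‖) ∧ (∀ w : E, P w = 0 → ‖S w‖ ≤ θ * ‖w‖)) ∧ 1 < μ ∧ (∀ t : ℝ, |t| < r₀ → (T ((0 : E), t)).1 = 0) ∧ π dstar = 0 ∧ (∀ F : EuclideanSpace ℝ (Fin 1) → Literature.Geometry.Lorentzian.InitialDataSet (𝓡 3) X, Literature.Geometry.Lorentzian.InitialDataSet.IsSmoothDataFamily 1 F → F 0 = dstar → (∀ c, F c ∈ Literature.Geometry.Lorentzian.admissibleVacuumData X) → (∃ C : Set X, IsCompact C ∧ ∀ c, ∀ x ∉ C, (F c).h.inner x = dstar.h.inner x ∧ (F c).k x = dstar.k x) → ∃ δ : ℝ, 0 < δ ∧ ContinuousOn (fun c ↦ π (F c)) (Metric.ball 0 δ)) ∧ ∀ r : ℝ, 0 < r → ∃ (σ₁ σ₂ ε₂ : ℝ) (G₁ G₂ : E × ℝ → ℝ), 0 < ε₂ ∧ (0 < σ₁ ∧ σ₁ < r ∧ -r < σ₂ ∧ σ₂ < 0 ∧ (∃ r' :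 ℝ, 0 < r' ∧ ContDiffOn ℝ 1 G₁ (Metric.ball ((0 : E), σ₁) r') ∧ ContDiffOn ℝ 1 G₂ (Metric.ball ((0 : E), σ₂) r')) ∧ G₁ ((0 : E), σ₁) = 0 ∧ fderiv ℝ G₁ ((0 : E), σ₁) ((0 : E), (1 : ℝ)) ≠ 0 ∧ G₂ ((0 : E), σ₂) = 0 ∧ fderiv ℝ G₂ ((0 : E), σ₂) ((0 : E), (1 : ℝ)) ≠ 0) ∧ ∀ F : EuclideanSpace ℝ (Fin 1) → Literature.Geometry.Lorentzian.InitialDataSet (𝓡 3) X, Literature.Geometry.Lorentzian.InitialDataSet.IsSmoothDataFamily 1 F → F 0 = dstar → (∀ c, F c ∈ Literature.Geometry.Lorentzian.admissibleVacuumData X) → (∃ C : Set X, IsCompact C ∧ ∀ c, ∀ x ∉ C, (F c).h.inner x = dstar.h.inner x ∧ (F c).k x = dstar.k x) → ∃ δ : ℝ, 0 < δ ∧ ∀ c ∈ Metric.ball (0 : EuclideanSpace ℝ (Fin 1)) δ, ((∀ n : ℕ, T^[n] (π (F c)) ∈ Metric.ball (0 : E × ℝ) ε₂) ∨ (∃ n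 : ℕ, T^[n] (π (F c)) ∈ Metric.ball ((0 : E), σ₁) ε₂ ∧ G₁ (T^[n] (π (F c))) = 0) ∨ (∃ n : ℕ, T^[n] (π (F c)) ∈ Metric.ball ((0 : E), σ₂) ε₂ ∧ G₂ (T^[n] (π (F c))) = 0)) → ∀ 𝒟 : Literature.Geometry.Lorentzian.VacuumCauchyDevelopment (F c), 𝒟.IsMaximal → ∀ [𝒟.metric.HasLeviCivita], ∃ (γ : ℝ → 𝒟.carrier) (dom : Set ℝ), (Literature.Geometry.Lorentzian.IsMaximalGeodesicOn 𝒟.metric.leviCivita γ dom ∧ (0 : ℝ) ∈ dom ∧ BddAbove dom ∧ (∀ t ∈ dom, 𝒟.metric.IsNull (Literature.Geometry.Lorentzian.velocity (𝓡 4) γ t) ∧ 𝒟.timeOrientation.IsFutureDirected (Literature.Geometry.Lorentzian.velocity (𝓡 4) γ t)) ∧ (∀ t ∈ dom, 0 ≤ t → (∃ (p : X) (δ' : ℝ → 𝒟.carrier) (s : Set ℝ), 𝒟.metric.IsNormalisedNullRayFrom 𝒟.timeOrientation 𝒟.embed 𝒟.normal p δ' s ∧ ¬ BddAbove s ∧ γ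 t ∈ 𝒟.metric.chronologicalPast 𝒟.timeOrientation (δ' '' (s ∩ Set.Ici 0)))))) → (∀ (X : Type) [TopologicalSpace X] [ChartedSpace Literature.Geometry.Lorentzian.E3 X] [IsManifold (𝓡 3) ((⊤ : ℕ∞) : WithTop ℕ∞) X] [T2Space X] [SecondCountableTopology X] [ConnectedSpace X], ∀ D ∈ Literature.Geometry.Lorentzian.admissibleVacuumData X, ∀ 𝒟 : Literature.Geometry.Lorentzian.VacuumCauchyDevelopment D, 𝒟.IsMaximal → (∀ [𝒟.metric.HasLeviCivita], ∃ (γ : ℝ → 𝒟.carrier) (dom : Set ℝ), (Literature.Geometry.Lorentzian.IsMaximalGeodesicOn 𝒟.metric.leviCivita γ dom ∧ (0 : ℝ) ∈ dom ∧ BddAbove dom ∧ (∀ t ∈ dom, 𝒟.metric.IsNull (Literature.Geometry.Lorentzian.velocity (𝓡 4) γ t) ∧ 𝒟.timeOrientation.IsFutureDirected (Literature.Geometry.Lorentzian.velocity (𝓡 4) γ t)) ∧ (∀ t ∈ dom, 0 ≤ t → (∃ (p : X) (δ' : ℝ → 𝒟.carrier) (s : Set ℝ), 𝒟.metric.IsNormalisedNullRayFrom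 𝒟.timeOrientation 𝒟.embed 𝒟.normal p δ' s ∧ ¬ BddAbove s ∧ γ t ∈ 𝒟.metric.chronologicalPast 𝒟.timeOrientation (δ' '' (s ∩ Set.Ici 0)))))) → ¬ (Summit.FinalStateConjecture.HasCompleteNullInfinity 𝒟.toCauchyDevelopment ∧ ∃ (O : Set 𝒟.carrier) (d : Literature.Geometry.Lorentzian.FinalStateDecomposition 𝒟.toSpacetime O 2), (∀ i, Literature.Geometry.Lorentzian.Kerr.IsSubextremal (d.mass i) (d.spin i)) ∧ O = Summit.FinalStateConjecture.exteriorOf 𝒟.toCauchyDevelopment d.charted ∧ Summit.FinalStateConjecture.RaysStayInClosure 𝒟.toCauchyDevelopment O ∧ Summit.FinalStateConjecture.HasExhaustiveCharts d ∧ Summit.FinalStateConjecture.IsFutureOriented d)) → Summit.FinalStateConjecture.FinalStateConjecture.Theses.LaminatedThreshold.LaminatedThreshold :=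
  fun hL hC hN ↦ laminatedThreshold_of_cagedComb_verbatim hL (cagedCombCarrier_of_explicitCage hC) hN

/-- **The crux from an explicitly caged comb carrier** (registered support statement
`laminatedThreshold_of_explicitCage`, abbreviated with `IsVisibleIncompleteNullRay` / `SettlesT2`). [folklore] -/
theorem laminatedThreshold_of_explicitCage : (∀ (E : Type) [NormedAddCommGroup E] [NormedSpace ℝ E] [CompleteSpace E] (T : E × ℝ → E × ℝ) (S : E →L[ℝ] E) (μ r₀ : ℝ), T 0 = 0 → 0 < r₀ → ContDiffOn ℝ 1 T (Metric.ball 0 r₀) → HasFDerivAt T ((S.comp (ContinuousLinearMap.fst ℝ E ℝ)).prod (μ • ContinuousLinearMap.snd ℝ E ℝ)) 0 → ‖S‖ < 1 → 1 < μ → (∀ t : ℝ, |t| < r₀ → (T ((0 : E), t)).1 = 0) → ∃ r₁ : ℝ, 0 < r₁ ∧ ∀ (σ₁ σ₂ : ℝ) (G₁ G₂ : E × ℝ → ℝ), 0 < σ₁ ∧ σ₁ < r₁ ∧ -r₁ < σ₂ ∧ σ₂ < 0 ∧ (∃ r' : ℝ, 0 < r' ∧ ContDiffOn ℝ 1 G₁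 (Metric.ball ((0 : E), σ₁) r') ∧ ContDiffOn ℝ 1 G₂ (Metric.ball ((0 : E), σ₂) r')) ∧ G₁ ((0 : E), σ₁) = 0 ∧ fderiv ℝ G₁ ((0 : E), σ₁) ((0 : E), (1 : ℝ)) ≠ 0 ∧ G₂ ((0 : E), σ₂) = 0 ∧ fderiv ℝ G₂ ((0 : E), σ₂) ((0 : E), (1 : ℝ)) ≠ 0 → ∀ ε : ℝ, 0 < ε → ∃ ρ : ℝ, 0 < ρ ∧ ∃ (Φ : E × ℝ → ℝ) (K : Set ℝ), Φ 0 = 0 ∧ (0 : ℝ) ∈ K ∧ (∀ η : ℝ, 0 < η → (K ∩ Set.Ioo (0 - η) 0).Nonempty ∧ (K ∩ Set.Ioo 0 (0 + η)).Nonempty) ∧ ContinuousOn Φ (Metric.ball 0 ρ) ∧ ∀ p ∈ Metric.ball (0 : E × ℝ) ρ, Φ p ∈ K → ((∀ n : ℕ, T^[n] p ∈ Metric.ball (0 : E × ℝ) ε) ∨ (∃ n : ℕ, T^[n] p ∈ Metric.ball ((0 : E), σ₁) ε ∧ G₁ (T^[n] p) = 0) ∨ (∃ n : ℕ, T^[n]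 p ∈ Metric.ball ((0 : E), σ₂) ε ∧ G₂ (T^[n] p) = 0))) → (∃ (X : Type) (_ : TopologicalSpace X) (_ : ChartedSpace E3 X) (_ : IsManifold (𝓡 3) ((⊤ : ℕ∞) : WithTop ℕ∞) X) (_ : T2Space X) (_ : SecondCountableTopology X) (_ : ConnectedSpace X) (dstar : InitialDataSet (𝓡 3) X) (E : Type) (_ : NormedAddCommGroup E) (_ : NormedSpace ℝ E) (_ : CompleteSpace E) (T : E × ℝ → E × ℝ) (S : E →L[ℝ] E) (μ r₀ : ℝ) (π : InitialDataSet (𝓡 3) X → E × ℝ) (P : E →L[ℝ] E) (Vs : Submodule ℝ E) (θ : ℝ), dstar ∈ admissibleVacuumData X ∧ T 0 = 0 ∧ 0 < r₀ ∧ ContDiffOn ℝ 1 T (Metric.ball 0 r₀) ∧ HasFDerivAt T ((S.comp (ContinuousLinearMap.fst ℝ E ℝ)).prod (μ • ContinuousLinearMap.snd ℝ E ℝ)) 0 ∧ (0 ≤ θ ∧ θ < 1 ∧ (∀ x : E, S (P x) = P (S x)) ∧ (∀ x : E, P x ∈ Vs) ∧ (∀ v ∈ Vs, P v = v) ∧ (∀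 v ∈ Vs, S v ∈ Vs) ∧ (∀ v ∈ Vs, ‖S v‖ ≤ θ * ‖v‖) ∧ (∀ w : E, P w = 0 → ‖S w‖ ≤ θ * ‖w‖)) ∧ 1 < μ ∧ (∀ t : ℝ, |t| < r₀ → (T ((0 : E), t)).1 = 0) ∧ π dstar = 0 ∧ (∀ F : EuclideanSpace ℝ (Fin 1) → InitialDataSet (𝓡 3) X, InitialDataSet.IsSmoothDataFamily 1 F → F 0 = dstar → (∀ c, F c ∈ admissibleVacuumData X) → (∃ C : Set X, IsCompact C ∧ ∀ c, ∀ x ∉ C, (F c).h.inner x = dstar.h.inner x ∧ (F c).k x = dstar.k x) → ∃ δ : ℝ, 0 < δ ∧ ContinuousOn (fun c ↦ π (F c)) (Metric.ball 0 δ)) ∧ ∀ r : ℝ, 0 < r → ∃ (σ₁ σ₂ ε₂ : ℝ) (G₁ G₂ : E × ℝ → ℝ), 0 < ε₂ ∧ (0 < σ₁ ∧ σ₁ < r ∧ -r < σ₂ ∧ σ₂ < 0 ∧ (∃ r' : ℝ, 0 < r' ∧ ContDiffOn ℝ 1 G₁ (Metric.ball ((0 : E), σ₁) r') ∧ ContDiffOn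 ℝ 1 G₂ (Metric.ball ((0 : E), σ₂) r')) ∧ G₁ ((0 : E), σ₁) = 0 ∧ fderiv ℝ G₁ ((0 : E), σ₁) ((0 : E), (1 : ℝ)) ≠ 0 ∧ G₂ ((0 : E), σ₂) = 0 ∧ fderiv ℝ G₂ ((0 : E), σ₂) ((0 : E), (1 : ℝ)) ≠ 0) ∧ ∀ F : EuclideanSpace ℝ (Fin 1) → InitialDataSet (𝓡 3) X, InitialDataSet.IsSmoothDataFamily 1 F → F 0 = dstar → (∀ c, F c ∈ admissibleVacuumData X) → (∃ C : Set X, IsCompact C ∧ ∀ c, ∀ x ∉ C, (F c).h.inner x = dstar.h.inner x ∧ (F c).k x = dstar.k x) → ∃ δ : ℝ, 0 < δ ∧ ∀ c ∈ Metric.ball (0 : EuclideanSpace ℝ (Fin 1)) δ, ((∀ n : ℕ, T^[n] (π (F c)) ∈ Metric.ball (0 : E × ℝ) ε₂) ∨ (∃ n : ℕ, T^[n] (π (F c)) ∈ Metric.ball ((0 : E), σ₁) ε₂ ∧ G₁ (T^[n] (π (F c))) = 0) ∨ (∃ n : ℕ, T^[n] (π (F c)) ∈ Metric.ball ((0 :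 E), σ₂) ε₂ ∧ G₂ (T^[n] (π (F c))) = 0)) → ∀ 𝒟 : VacuumCauchyDevelopment (F c), 𝒟.IsMaximal → ∀ [𝒟.metric.HasLeviCivita], ∃ (γ : ℝ → 𝒟.carrier) (dom : Set ℝ), 𝒟.IsVisibleIncompleteNullRay γ dom) → (∀ (X : Type) [TopologicalSpace X] [ChartedSpace E3 X] [IsManifold (𝓡 3) ((⊤ : ℕ∞) : WithTop ℕ∞) X] [T2Space X] [SecondCountableTopology X] [ConnectedSpace X], ∀ D ∈ admissibleVacuumData X, ∀ 𝒟 : VacuumCauchyDevelopment D, 𝒟.IsMaximal → (∀ [𝒟.metric.HasLeviCivita], ∃ (γ : ℝ → 𝒟.carrier) (dom : Set ℝ), 𝒟.IsVisibleIncompleteNullRay γ dom) → ¬ Summit.FinalStateConjecture.FinalStateConjecture.Theorems.ClusterCompleteness.SettlesT2 𝒟) → Summit.FinalStateConjecture.FinalStateConjecture.Theses.LaminatedThreshold.LaminatedThreshold :=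
  fun hL hC hN ↦ laminatedThreshold_of_explicitCage_verbatim hL hC hN

end Summit.FinalStateConjecture.FinalStateConjecture.Theorems.LaminatedThreshold.CagedComb

end
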